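import Literature.Geometry.Riemannian.ThreeShrinkerNullRicci
import Literature.Geometry.Riemannian.RicciNonnegInfiniteVolumeProofs
import HarnessLib

/-!
# The classification of complete three-dimensional gradient shrinking Ricci solitons: discharge

Final assembly of the named fact
`Literature.Geometry.Riemannian.threeShrinkerClassification_modelData`
(`ThreeShrinkerClassification.lean`; O. Munteanu, J. Wang, arXiv:1606.01861, Thm. 1.2; earlier
Ivey, Perelman, Ni–Wallach, Cao–Chen–Zhu 2008: a complete connected normalised three-dimensional
gradient shrinker is, up to the weighted-volume data recorded by the fact, the Gaussian soliton,
a quotient of the round `S³(2)`, or a quotient of the round cylinder `S²(√2) × ℝ`).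

The literature seat and the leads of the crux line `collapsed-ends-usc` of
`EntropyRung.NoncompactShrinkerGap` reduced the fact to two curvature inputs on complete noncompact
shrinkers with `R > 0` (`ThreeShrinkerClassificationAssembly.lean`): (F1) `Ric ≥ 0` — a theorem
(`ThreeShrinker.ricci_nonneg`, `ThreeShrinkerSectionalNonneg.lean`, B.-L. Chen 2009, Cor. 2.4, by
an elliptic Hamilton–Ivey maximum principle) — and (F2) a null vector of `Ric` (Munteanu–Wang 2017,
Thm. 2, contrapositive), itself a theorem MODULO Calabi–Yau's infinite-volume theorem
(`ThreeShrinker.exists_ricci_null_of_infiniteVolume`, `ThreeShrinkerNullRicci.lean`). Calabi–Yau is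
now a theorem of the tree (`ricciNonneg_infiniteVolume_holds`, `RicciNonnegInfiniteVolumeProofs.lean`:
Bishop's comparison transferred to `exp_p` and Yau's argument by homothety), so:

* `ThreeShrinker.exists_ricci_null` — **(F2) unconditionally**;
* `threeShrinkerClassification_modelData_holds` — **the classification fact, discharged**.

## References

* O. Munteanu, J. Wang, *Positively curved shrinking Ricci solitons are compact*, J. Differential
  Geom. 106 (2017) = arXiv:1504.07898, Thm. 2. [MunteanuWang2017]
* O. Munteanu, J. Wang, arXiv:1606.01861, Thm. 1.2 (p. 3). [MunteanuWang2016]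
* S.-T. Yau, Indiana Univ. Math. J. 25 (1976) 659–670. [Yau1976]
-/

noncomputable section

open Set
open scoped Manifold ContDiff NNReal

namespace Literature.Geometry.Riemannian

open Lorentzian Lorentzian.PseudoRiemannianMetric

namespace ThreeShrinker

/-- **(F2) Munteanu–Wang 2017, Thm. 2, contrapositive, `n = 3` — unconditionally**: on a
complete connected normalised noncompact three-dimensional gradient shrinker with `R > 0` the Ricci
form has a null vector somewhere (`exists_ricci_null_of_infiniteVolume` fed with Calabi–Yau,
`ricciNonneg_infiniteVolume_holds`). [cite: MunteanuWang2017, Thm. 2] -/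
theorem exists_ricci_null
    (N : Type) [TopologicalSpace N] [T2Space N] [SecondCountableTopology N]
    [ChartedSpace (EuclideanSpace ℝ (Fin 3)) N] [IsManifold (𝓡 3) ∞ N] [ConnectedSpace N]
    [T3Space N] [MeasurableSpace N] [BorelSpace N]
    (h : PseudoRiemannianMetric (𝓡 3) ∞ (EuclideanSpace ℝ (Fin 3))
      (TangentSpace (𝓡 3) : N → Type _)) [h.HasLeviCivita] (φ : N → ℝ) (hh : h.IsRiemannian)
    (hcpl : ∀ (x : N) (r : ℝ≥0), IsCompact {y : N | h.edist hh x y ≤ r})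
    (hφ : ContMDiff (𝓡 3) 𝓘(ℝ, ℝ) ∞ φ)
    (hsol : ∀ (x : N) (X Y : TangentSpace (𝓡 3) x),
      h.ricci x X Y + h.hessian φ x X Y = (1 / 2 : ℝ) * h.val x X Y)
    (hnorm : ∀ x : N, h.scalarCurvature x + h.gradSq φ x = φ x)
    (hnc : NoncompactSpace N) (hR : ∀ x : N, 0 < h.scalarCurvature x) :
    ∃ (p : N) (w : TangentSpace (𝓡 3) p), w ≠ 0 ∧ h.ricci p w w = 0 :=
  exists_ricci_null_of_infiniteVolume ricciNonneg_infiniteVolume_holds N h φ hh hcpl hφ hsol hnorm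
    hnc hR

end ThreeShrinker

/-- **The classification of complete three-dimensional gradient shrinking Ricci solitons
(Munteanu–Wang 2016, Thm. 1.2), discharged**: `threeShrinkerClassification_modelData` holds —
`threeShrinkerClassification_modelData_of_infiniteVolume` fed with Calabi–Yau's infinite-volume
theorem `ricciNonneg_infiniteVolume_holds`.
[cite: MunteanuWang2016, Thm. 1.2 (p. 3)] [cite: MunteanuWang2017, Thm. 2] -/
theorem threeShrinkerClassification_modelData_holds : threeShrinkerClassification_modelData :=
  threeShrinkerClassification_modelData_of_infiniteVolume ricciNonneg_infiniteVolume_holds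

end Literature.Geometry.Riemannian

end
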